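import Summits.BirchSwinnertonDyer.BirchSwinnertonDyer.Theorems.GenusKolyvaginAtTwoKolyvaginRelationAtTwoOrders
import Summits.BirchSwinnertonDyer.BirchSwinnertonDyer.Theorems.GenusKolyvaginAtTwoKolyvaginRelationAtTwoReductionDatum
import Summits.BirchSwinnertonDyer.Rank1Residual.X11b.KolyvaginH44OfEulerCongruence

/-!
# Route `GenusKolyvaginAtTwo`, LINE 6, Q2 `KolyvaginRelationAtTwo`: both local order equalities
# at a Kolyvagin prime (Zhang's currency, ANY `p`, so `p = 2`) from the HEEGNER-POINT / RING-CLASS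
# inputs alone — Prop. 3.7 (1)(2), splitting, total ramification (helper, PROVED; seat gk2-p2 g5)

Assembly of the seat's three Q2 files (`…Charpoly`, `…Orders`, `…ReductionDatum`) in the currency
of the `b2b-bsdres` team's `h44` programme (`X11b/KolyvaginH44OfEulerCongruence`, the END
`h44_of_prop37_of_ringClassDecomposition` at odd `p`): for a globally minimal `E = W/ℚ`, `K`
imaginary quadratic, `ℓ` a Kolyvagin prime in ZHANG's form (`Zhang2014.IsKolyvaginPrime N W K p ℓ`,
`M ≤ M(ℓ)`: `p^M ∣ ℓ + 1`, `p^M ∣ a_ℓ`, `ℓ` inert — no Frobenius-class condition, no Weil pairing,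
no `p ≠ 2`), abstract level-`mℓ` Euler data `𝒢 ↷ A`, `σ`, `L ∋ ℓ`, `H`, `f`, `y`, `π : Γ_K → 𝒢`,
`j : A → E(K̄)` (the ring class field `K[mℓ]` and its points), the Kolyvagin point
`P₁ = j(P_{mℓ})`, a lower point `P₂ = P_m` with McCallum's admissibility / invariance, and the
LABELLED inputs of that programme —
* `hrel` + `hES` + `hy'P` = **Gross 1991 Prop. 3.7** (1) `Tr_ℓ y_{mℓ} = a_ℓ y'`, (2)
  `y_{mℓ} ≡ Frob · y' (mod λ_{mℓ})` for the tree's reduction along `placeOver ℓ` and all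
  `𝒢`-conjugates, with the inter-level identity `j(P'_{mℓ}) = P_m`;
* `hsplit` = *"`λ` splits completely in `K_m`"* (every Frobenius at `𝔓 ∣ λ` fixes `P_m`);
* `hram` = *"`λ_m` ramifies totally in `K_{mℓ}`, `Gal = ⟨σ_ℓ⟩`"*: the inertia at `𝔓` AND every
  Frobenius at `𝔓` act on `j(A)` through `⟨σ_ℓ⟩`, with some `τ₀ ↦ σ_ℓ`;
* `hsel₂` = McCallum Lemma 4.3 / Gross 6.2 (1) (`c_M(m)` Selmer at `λ ∤ m`),
this file proves, for every `k`: **(`k c(P₁)` Selmer at `λ` iff `k c(P₁)_λ = 0`) and (`k c(P₁)_λ = 0`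
iff `k c(P₂)_λ = 0`)** — McCallum Prop. 4.4 «in particular», both equalities, i.e. the two conjuncts
of Q2, at EVERY prime `p`. The reduction datum is DISCHARGED (`exists_reductionDatum_of_charpoly`,
Frobenius equation + divisibility), the Euler-system root is the tree's
`KolyvaginEuler.exists_root_of_relation`, and the one new group-ring identity is
`map_kolyvaginPoint_eq_smul_of_forall_smul_eq` (`red P_{mℓ} = (Σ_{i ≤ ℓ} i) · red P'_{mℓ}` when
`σ_ℓ` acts trivially after `red` — `σ_ℓ` is inertia at `λ`).

HONEST FRAMING. Parity with the odd-`p` `h44` END, at `p = 2`: the labelled remainder is the SAME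
({Prop. 3.7, splitting, total ramification, Lemma 4.3, admissibility}), all statements about Heegner
points and ring class fields with no `p` in them; nothing `2`-specific is left. Q2 is not closed by
name (its binders are the tree's `KolyvaginHeegnerData`; the dictionary abstract ↔ concrete is the
`X11b/KolyvaginH44Concrete` plumbing, not redone here). BSD is not proved by any of this.

References: [GrossLMS1991] §3 (3.3)–(3.5), Prop. 3.6, 3.7, §4 (4.1), Prop. 6.2; [McCallumLMS1991]
§4 Lemma 4.3, Prop. 4.4; [WZhang2014] Notations (xii); [SilvermanAEC2009] V.2.3.1, VII.3.1.
-/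

set_option autoImplicit false
set_option linter.dupNamespace false

noncomputable section

open scoped Classical Pointwise

namespace Summit.BirchSwinnertonDyer.BirchSwinnertonDyer.Theorems.GenusExact

open WeierstrassCurve Field NumberField IsDedekindDomain Finset
open Literature.NumberTheory.EllipticCurves Literature.NumberTheory.GaloisRepresentations
open Literature.NumberTheory.EllipticCurves.KolyvaginCocycle
open Literature.NumberTheory.EllipticCurves.KolyvaginEuler
open Rat.HeightOneSpectrum
open Summit.BirchSwinnertonDyer.Rank1Residual.X11b.KolyvaginH44

/-! ### §1 Group-ring identity: `red P_{mℓ} = (Σ_{i ≤ ℓ} i) · red P'_{mℓ}` when `σ_ℓ` is invisible to `red` -/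

section GroupRing

variable {𝒢 : Type*} [CommGroup 𝒢] {A : Type*} [AddCommGroup A] [DistribMulAction 𝒢 A]
variable {B : Type*} [AddCommGroup B]

/-- If the additive `ρ` does not see `σ` (`ρ(σ • a) = ρ a`: `σ = σ_ℓ` is inertia at `λ` and `ρ` the
reduction), then `ρ(D_ℓ a) = (Σ_{i ≤ ℓ} i) · ρ(a)` for Kolyvagin's `D_ℓ = Σ i σ^i`.
[cite: GrossLMS1991, §3 (3.5)] -/
theorem map_grAct_derivElt_of_forall_smul_eq (ρ : A →+ B) {σ : 𝒢} (hσ : ∀ a : A, ρ (σ • a) = ρ a)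
    (ℓ : ℕ) (a : A) :
    ρ (grAct A (derivElt σ ℓ) a) = (∑ i ∈ range (ℓ + 1), i) • ρ a := by
  have hpow : ∀ (i : ℕ) (a : A), ρ (σ ^ i • a) = ρ a := by
    intro i
    induction i with
    | zero => intro a; rw [pow_zero, one_smul]
    | succ i ih => intro a; rw [pow_succ, mul_smul, ih, hσ]
  rw [grAct_derivElt, map_sum, sum_smul]
  refine sum_congr rfl fun i _ ↦ ?_
  rw [map_nsmul, hpow]

/-- **`ρ(P_n) = (Σ_{i ≤ ℓ} i) · ρ(P'_n)`** for Kolyvagin's points `P_n = Σ_S s D_ℓ D_{n/ℓ} y` and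
`P'_n = Σ_S s D_{n/ℓ} y` (same `y`, same representatives), when `ρ` does not see `σ_ℓ`.
[cite: GrossLMS1991, §4 (4.1), §3 (3.5)] -/
theorem map_kolyvaginPoint_eq_smul_of_forall_smul_eq (ρ : A →+ B) {σ : ℕ → 𝒢} {L : Finset ℕ}
    {ℓ : ℕ} (hℓ : ℓ ∈ L) (hσ : ∀ a : A, ρ (σ ℓ • a) = ρ a) {H : Subgroup 𝒢} [Fintype (𝒢 ⧸ H)]
    (f : 𝒢 ⧸ H → 𝒢) (y : A) :
    ρ (kolyvaginPoint σ L f y) = (∑ i ∈ range (ℓ + 1), i) • ρ (kolyvaginPoint σ (L.erase ℓ) f y) := by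
  unfold kolyvaginPoint
  rw [map_sum, map_sum, smul_sum]
  refine sum_congr rfl fun q _ ↦ ?_
  have hD : derivProd σ L = derivElt (σ ℓ) ℓ * derivProd σ (L.erase ℓ) := by
    unfold derivProd
    rw [mul_prod_erase L (fun ℓ ↦ derivElt (σ ℓ) ℓ) hℓ]
  rw [hD, grAct_mul, ← grAct_smul_comm, map_grAct_derivElt_of_forall_smul_eq ρ hσ]

end GroupRing

/-! ### §2 The inert place of a Zhang–Kolyvagin prime -/

section Place

variable {K : Type} [Field K] [NumberField K] {N : ℕ} {W : WeierstrassCurve ℚ} [W.IsGloballyMinimal]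
  {p ℓ : ℕ}

/-- **`λ ∋ ℓ` is the only place above the inert Kolyvagin prime `ℓ`** (Zhang's form: `(ℓ)` is a
prime ideal of `𝓞 K`). [cite: WZhang2014, Notations (xii)] [cite: GrossLMS1991, §3] -/
theorem eq_of_natCast_mem_of_zhangKolyvaginPrime (hℓ : Zhang2014.IsKolyvaginPrime N W K p ℓ)
    {v w : HeightOneSpectrum (𝓞 K)} (hv : (ℓ : 𝓞 K) ∈ v.asIdeal) (hw : (ℓ : 𝓞 K) ∈ w.asIdeal) :
    w = v := by
  have hI : (Ideal.span {(ℓ : 𝓞 K)}).IsPrime := hℓ.2.2.2.2.1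
  have hne : Ideal.span {(ℓ : 𝓞 K)} ≠ ⊥ := by
    rw [Ne, Ideal.span_singleton_eq_bot]
    exact_mod_cast hℓ.1.ne_zero
  have hmax := Ideal.IsPrime.isMaximal hI hne
  have h1 : v.asIdeal = Ideal.span {(ℓ : 𝓞 K)} :=
    (hmax.eq_of_le v.isPrime.ne_top ((Ideal.span_singleton_le_iff_mem _).mpr hv)).symm
  have h2 : w.asIdeal = Ideal.span {(ℓ : 𝓞 K)} :=
    (hmax.eq_of_le w.isPrime.ne_top ((Ideal.span_singleton_le_iff_mem _).mpr hw)).symm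
  exact HeightOneSpectrum.ext (h2.trans h1.symm)

/-- **`q_λ = ℓ²`** at the inert Kolyvagin prime (Zhang's form), `K` imaginary quadratic: `ℓ` is
unramified (`(ℓ)` prime) and has a single place above it, so its residue degree is `[K:ℚ] = 2`.
[cite: GrossLMS1991, §3 ("F_λ has ℓ² elements")] [cite: WZhang2014, Notations (xii)] -/
theorem residueCard_eq_sq_of_zhangKolyvaginPrime (hK : IsImaginaryQuadratic K)
    (hℓ : Zhang2014.IsKolyvaginPrime N W K p ℓ) {v : HeightOneSpectrum (𝓞 K)}
    (hv : (ℓ : 𝓞 K) ∈ v.asIdeal) : v.residueCard = ℓ ^ 2 := by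
  haveI : Algebra.IsQuadraticExtension ℚ K := ⟨hK.1⟩
  haveI : Fact ℓ.Prime := ⟨hℓ.1⟩
  obtain ⟨v₀, hv₀, hℓv₀⟩ := exists_ratPlace ℓ
  haveI := v.isPrime
  have hw : v.asIdeal.under (𝓞 ℚ) = v₀.asIdeal :=
    Rat.under_eq_asIdeal_of_natCast_mem hℓ.1 hℓv₀ hv
  have hw' : v.under (𝓞 ℚ) = v₀ := HeightOneSpectrum.ext hw
  have hunr : Algebra.IsUnramifiedIn (𝓞 K) v₀.asIdeal :=
    isUnramifiedIn_of_span_natCast_isPrime hℓ.1 hℓ.2.2.2.2.1 hℓv₀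
  have h2 : (Module.finrank ℚ K).Prime := by rw [hK.1]; exact Nat.prime_two
  have hq : v₀.residueCard = ℓ := by rw [Rat.residueCard_eq_natGenerator]; exact hv₀
  rcases placesOver_dichotomy_of_prime (F := ℚ) (M := K) h2 hunr with ⟨hN, -⟩ | ⟨-, hf⟩
  · exfalso
    have h1 : Nat.card {w : HeightOneSpectrum (𝓞 K) // w.under (𝓞 ℚ) = v₀} = 1 := by
      rw [Nat.card_eq_one_iff_exists]
      refine ⟨⟨v, hw'⟩, fun w ↦ Subtype.ext (eq_of_natCast_mem_of_zhangKolyvaginPrime hℓ hv ?_)⟩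
      haveI := w.1.isPrime
      have hmem : (ℓ : 𝓞 ℚ) ∈ (w.1.under (𝓞 ℚ)).asIdeal := by rw [w.2]; exact hℓv₀
      rw [HeightOneSpectrum.under_asIdeal, Ideal.under_def, Ideal.mem_comap, map_natCast] at hmem
      exact hmem
    rw [h1, hK.1] at hN
    exact absurd hN (by decide)
  · rw [residueCard_eq_residueCard_pow_inertiaDeg hw, hf v hw', hK.1, hq]

end Place

/-! ### §3 Both local order equalities from the Heegner-point / ring-class inputs, any `p` -/

section Main

variable {K : Type} [Field K] [NumberField K]

set_option maxHeartbeats 800000 in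
/-- **McCallum Prop. 4.4 «in particular» — `ord d_M(mℓ)_λ = ord c_M(mℓ)_λ = ord c_M(m)_λ` — at a
Kolyvagin prime in Zhang's currency, ANY prime `p` (so `p = 2`), from the Heegner-point / ring-class
inputs of the odd-`p` `h44` programme.** `E = W/ℚ` globally minimal, `K` imaginary quadratic, `ℓ` a
Zhang–Kolyvagin prime with `M ≤ M(ℓ)`, good reduction at the place `v₀ ∋ ℓ` of `ℚ` and at `λ ∋ ℓ`;
abstract Euler data at level `mℓ` (`𝒢 ↷ A` commutative, `σ`, `L ∋ ℓ` with `σ_ℓ^{ℓ+1} = 1`, `H`, a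
section `f`, `y`, `π : Γ_K → 𝒢`, `j : A → E(K̄)` equivariant), `P₁ = j(P_{mℓ})` admissible-invariant
for `p^M` in `A₁ = j(A)`, a point `P₂` admissible-invariant in `A₂` with `c(P₂)` Selmer at `λ`
(`hsel₂`, McCallum Lemma 4.3), and the LABELLED inputs: `hrel` (Prop. 3.7 (1): `Tr_ℓ y = a_ℓ y'`),
`hy'P` (the inter-level identity `j(P'_{mℓ}) = P₂`), `hES` (Prop. 3.7 (2) for the tree's reduction
along `placeOver ℓ`, all `𝒢`-conjugates), `hsplit` (every Frobenius at `𝔓 ∣ λ` fixes `P₂`), `hram`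
(some `τ₀ ↦ σ_ℓ` in `I_𝔓`; inertia AND Frobenii at `𝔓` act on `j(A)` through `⟨τ₀⟩`). Then for every
`k`: (`k c(P₁)` Selmer at `λ` iff `k c(P₁)_λ = 0`) and (`k c(P₁)_λ = 0` iff `k c(P₂)_λ = 0`).
[cite: McCallumLMS1991, Prop. 4.4] [cite: GrossLMS1991, Prop. 3.7, Prop. 6.2 (2)]
[cite: WZhang2014, Notations (xii)] -/
theorem zsmul_kolyvaginClass_localOrders_of_heegnerInputs {N : ℕ} {W : WeierstrassCurve ℚ}
    [W.IsElliptic] [W.IsGloballyMinimal] (hK : IsImaginaryQuadratic K)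
    {p : ℕ} [Fact p.Prime] {M ℓ : ℕ}
    (hℓ : Zhang2014.IsKolyvaginPrime N W K p ℓ) (hM : M ≤ Zhang2014.kolyvaginIndex W p ℓ)
    {v₀ : HeightOneSpectrum (𝓞 ℚ)} (hℓv₀ : (ℓ : 𝓞 ℚ) ∈ v₀.asIdeal) (hgood₀ : W.HasGoodReductionAt v₀)
    {v : HeightOneSpectrum (𝓞 K)} (hv : (ℓ : 𝓞 K) ∈ v.asIdeal)
    (hgood : (W.baseChange K).HasGoodReductionAt v)
    (hdiv : ∀ Q : geomPoints (W.baseChange K), ∃ R, ((p ^ M : ℕ) : ℤ) • R = Q)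
    {𝒢 : Type} [CommGroup 𝒢] {A : Type} [AddCommGroup A] [DistribMulAction 𝒢 A]
    (σ : ℕ → 𝒢) (L : Finset ℕ) (hℓL : ℓ ∈ L) (hord : σ ℓ ^ (ℓ + 1) = 1)
    {H : Subgroup 𝒢} [Fintype (𝒢 ⧸ H)] (f : 𝒢 ⧸ H → 𝒢) (y y' : A)
    (π : absoluteGaloisGroup K →* 𝒢) (j : A →+ geomPoints (W.baseChange K))
    (hj : ∀ (g : absoluteGaloisGroup K) (a : A), j (π g • a) = g • j a)
    (hA₁ : IsAdmissible (absoluteGaloisGroup K) j.range ((p ^ M : ℕ) : ℤ))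
    (hP₁ : j (kolyvaginPoint σ L f y) ∈ invPoints (absoluteGaloisGroup K) j.range ((p ^ M : ℕ) : ℤ))
    {A₂ : AddSubgroup (geomPoints (W.baseChange K))}
    (hA₂ : IsAdmissible (absoluteGaloisGroup K) A₂ ((p ^ M : ℕ) : ℤ))
    {P₂ : geomPoints (W.baseChange K)}
    (hP₂ : P₂ ∈ invPoints (absoluteGaloisGroup K) A₂ ((p ^ M : ℕ) : ℤ))
    (hsel₂ : kolyvaginClass (W.baseChange K) _ hdiv hA₂ P₂ hP₂ ∈
      selmerLocalKer (W.baseChange K) (v.adicCompletion K) ((p ^ M : ℕ) : ℤ))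
    -- Gross Prop. 3.7 (1), the inter-level identity, Prop. 3.7 (2)
    (hrel : grAct A (traceElt (σ ℓ) ℓ) y = W.frobeniusTrace ℓ • y')
    (hy'P : j (kolyvaginPoint σ (L.erase ℓ) f y') = P₂)
    (hES : ∀ [Fact ℓ.Prime] (hΔ : ¬ (ℓ : ℤ) ∣ minimalDiscriminantInt W)
      (φ₀ : absoluteGaloisGroup (ZMod ℓ)), (∀ x : AlgebraicClosure (ZMod ℓ), φ₀ • x = x ^ ℓ) →
      ∀ γ : 𝒢, geomReduction hΔ ((RatClosure.pointsEquiv (K := K) W).symm (j (γ • y))) =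
        φ₀ • geomReduction hΔ ((RatClosure.pointsEquiv (K := K) W).symm (j (γ • y'))))
    -- the ring-class decomposition at `λ`
    (hsplit : ∀ 𝔓 ∈ v.primesAbove, ∀ F : absoluteGaloisGroup K, IsArithFrobAt (𝓞 K) F 𝔓 →
      F • P₂ = P₂)
    (hram : ∀ 𝔓 ∈ v.primesAbove, ∃ τ₀ ∈ 𝔓.inertia (absoluteGaloisGroup K), π τ₀ = σ ℓ ∧
      (∀ τ ∈ 𝔓.inertia (absoluteGaloisGroup K), ∃ i : ℕ, ∀ x ∈ j.range, τ • x = (τ₀ ^ i) • x) ∧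
      (∀ F : absoluteGaloisGroup K, IsArithFrobAt (𝓞 K) F 𝔓 →
        ∃ i : ℕ, ∀ x ∈ j.range, F • x = (τ₀ ^ i) • x))
    (k : ℤ) :
    (k • kolyvaginClass (W.baseChange K) _ hdiv hA₁ (j (kolyvaginPoint σ L f y)) hP₁ ∈
          selmerLocalKer (W.baseChange K) (v.adicCompletion K) ((p ^ M : ℕ) : ℤ) ↔
        k • kolyvaginClass (W.baseChange K) _ hdiv hA₁ (j (kolyvaginPoint σ L f y)) hP₁ ∈
          (W.baseChange K).torsionLocalKer (v.adicCompletion K) ((p ^ M : ℕ) : ℤ)) ∧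
      (k • kolyvaginClass (W.baseChange K) _ hdiv hA₁ (j (kolyvaginPoint σ L f y)) hP₁ ∈
          (W.baseChange K).torsionLocalKer (v.adicCompletion K) ((p ^ M : ℕ) : ℤ) ↔
        k • kolyvaginClass (W.baseChange K) _ hdiv hA₂ P₂ hP₂ ∈
          (W.baseChange K).torsionLocalKer (v.adicCompletion K) ((p ^ M : ℕ) : ℤ)) := by
  have hp : p.Prime := Fact.out
  have hℓp : ℓ.Prime := hℓ.1
  haveI : Fact ℓ.Prime := ⟨hℓp⟩
  have hpℓ : p ≠ ℓ := fun h ↦ hℓ.2.2.2.1 h.symm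
  have hℓpM : ¬ ℓ ∣ p ^ M := fun h ↦
    hpℓ ((Nat.prime_dvd_prime_iff_eq hℓp hp).mp (hℓp.dvd_of_dvd_pow h)).symm
  have hpM0 : p ^ M ≠ 0 := pow_ne_zero M hp.ne_zero
  -- `ℓ ∤ Δ_W`
  obtain ⟨v₁, hv₁, hℓv₁⟩ := exists_ratPlace ℓ
  have hv₁₀ : v₁ = v₀ := Rat.natGenerator_injective
    ((Rat.natGenerator_eq_of_natCast_mem hℓp hℓv₁).trans
      (Rat.natGenerator_eq_of_natCast_mem hℓp hℓv₀).symm)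
  subst hv₁₀
  have hΔ : ¬ (ℓ : ℤ) ∣ minimalDiscriminantInt W := by
    have h1 := (hasGoodReductionAtPrime_iff_hasGoodReductionAt_ringOfIntegers v₁ W).mpr hgood₀
    have h2 := @not_dvd_minimalDiscriminantInt_of_hasGoodReductionAtPrime' W _
      (primesEquiv v₁ : ℕ) (Fact.mk (primesEquiv v₁).2) h1
    rwa [hv₁] at h2
  -- `p^M ∣ ℓ + 1`, `p^M ∣ a_ℓ`
  obtain ⟨h1, h2⟩ := Zhang2014.le_kolyvaginIndex_iff.mp hM
  obtain ⟨l', hl'⟩ : ((p : ℤ) ^ M) ∣ ((ℓ + 1 : ℕ) : ℤ) := by exact_mod_cast h1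
  obtain ⟨a', ha'⟩ : ((p : ℤ) ^ M) ∣ W.frobeniusTrace ℓ := by exact_mod_cast h2
  -- the inert place
  have huniq : ∀ w : HeightOneSpectrum (𝓞 K), (ℓ : 𝓞 K) ∈ w.asIdeal → w = v :=
    fun w hw ↦ eq_of_natCast_mem_of_zhangKolyvaginPrime hℓ hv hw
  have hres : v.residueCard = ℓ ^ 2 := residueCard_eq_sq_of_zhangKolyvaginPrime hK hℓ hv
  -- the Frobenius of `𝔽̄_ℓ`
  obtain ⟨φ₀, hφ₀'⟩ := exists_frobenius_absoluteGaloisGroup (ZMod ℓ)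
  have hφ₀ : ∀ x : AlgebraicClosure (ZMod ℓ), φ₀ • x = x ^ ℓ := fun x ↦ by
    rw [hφ₀' x, Nat.card_zmod]
  refine zsmul_kolyvaginClass_localOrders_of_zhangKolyvaginPrime W hK hℓ hM hℓv₀ hgood₀ hv hgood
    hA₁ hA₂ hP₁ hP₂ hsel₂ (a := W.frobeniusTrace ℓ) hl' ha' ?_ k
  intro 𝔓 h𝔓 F hF _hFfix
  refine ⟨hsplit 𝔓 h𝔓 F hF, ?_⟩
  obtain ⟨g, red, φ, hredg, hφ, hredI, hredF, hred, hcharB, hdivB⟩ :=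
    exists_reductionDatum_of_charpoly W hΔ hφ₀ hv huniq hres h𝔓 hℓpM hpM0 hF
  obtain ⟨τ₀, hτ₀I, hπτ₀, hIτ₀, hFτ₀⟩ := hram 𝔓 h𝔓
  -- Prop. 3.7 (2) for the reduction along `𝔓`
  have hES' : ∀ γ : 𝒢, red (j (γ • y)) = φ (red (j (γ • y'))) := by
    intro γ
    rw [hredg, hredg, hφ, ← hj, ← hj, ← mul_smul, ← mul_smul]
    exact hES hΔ φ₀ hφ₀ _
  -- the Euler-system root at `λ`
  have hlZ : ((ℓ + 1 : ℕ) : ℤ) = ((p ^ M : ℕ) : ℤ) * l' := by rw [hl']; push_cast; ring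
  have haZ : W.frobeniusTrace ℓ = ((p ^ M : ℕ) : ℤ) * a' := by rw [ha']; push_cast; ring
  obtain ⟨R₀, hR₀A, hR₀, hR₀red⟩ := exists_root_of_relation π j hj hℓL hord f hrel hlZ haZ hπτ₀
    red φ hES'
  rw [hy'P] at hR₀red
  -- `σ_ℓ` is invisible to `red ∘ j` (inertia), so `red P₁ = (Σ i) · red P'_{mℓ} = t · φ (red P₂)`
  have hσinv : ∀ a : A, (red.comp j) (σ ℓ • a) = (red.comp j) a := fun a ↦ by
    rw [AddMonoidHom.comp_apply, AddMonoidHom.comp_apply, ← hπτ₀, hj, hredI τ₀ hτ₀I]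
  have hP₁red : red (j (kolyvaginPoint σ L f y)) =
      ((∑ i ∈ range (ℓ + 1), i : ℕ) : ℤ) • φ (red P₂) := by
    have h := map_kolyvaginPoint_eq_smul_of_forall_smul_eq (red.comp j) hℓL hσinv f y
    rw [AddMonoidHom.comp_apply, AddMonoidHom.comp_apply] at h
    rw [h, natCast_zsmul, ← hy'P]
    congr 1
    have h2 := map_kolyvaginPoint_eq_of_forall (red.comp j) φ (fun γ ↦ hES' γ) σ (L.erase ℓ) f
    rw [AddMonoidHom.comp_apply, AddMonoidHom.comp_apply] at h2
    exact h2
  exact ⟨(reductionModPrime W ℓ).geomPoints, inferInstance, red, φ, τ₀, R₀, _, hredI, hredF, hred,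
    hcharB, hdivB, hτ₀I, hIτ₀, hFτ₀ F hF, hR₀A, hR₀, hR₀red, hP₁red⟩

end Main

end Summit.BirchSwinnertonDyer.BirchSwinnertonDyer.Theorems.GenusExact

end
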